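import Summits.BirchSwinnertonDyer.Rank1Residual.P2.TransportAtTwoShuZhai
import Literature.NumberTheory.EllipticCurves.BSDInvariantsMinimalModelProofs
import HarnessLib

/-!
# Sub-lane «bsd-p2»: the SPEC of the rank-ZERO exact engine as a kernel object —
# `BSD(E,2) ⟺ ord₂(L(E,1)/Ω_E) = ord₂ #Ш(E) + ord₂ ∏c_ℓ − 2·ord₂ #E(ℚ)_tor`

HONEST FRAMING (sub-lane «bsd-p2», run/shared/lean/b2b/bsd-rank1-residual/p2/, verbatim in every
file): the target of record is the FULL Birch–Swinnerton-Dyer formula for EVERY analytic-rank `≤ 1`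
`E/ℚ` at ALL primes INCLUDING `2`; the odd-prime class ledger is referee A's; the `2`-part is OPEN
(cells O1 = X5 ∖ CM and O12 = the CM corner) and under census by «bsd-p2». Census / instrument
output at `2` = EVIDENCE / conjecture items with held-out validation, NEVER a Literature fact;
certificates close PAIRS (one isogeny class, `p = 2`), never classes. This file asserts NO
arithmetic fact: binders Gross–Zagier–Kolyvagin over `ℚ` (`rank_eq_analyticRank_of_analyticRank_le_one`,
for `rank = 0` and the finiteness of `Ш`) and modularity (`hasEntireLFunction_rat`, for
`L(E,1) ≠ 0 ⟺ r_an = 0`). It is the rank-zero companion of `P2/HeegnerIndexAtTwo.lean` (the rank-one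
engine's SPEC): the per-pair statement that census-2's r = 0 columns decide (SPEC.md §3.1 / C1:
`LoverOmega := L(E,1)/Ω_E` EXACT by modular symbols, `Ω_E = ∫_{E(ℝ)}|ω|` over ALL real components =
the tree's `realPeriodRat` of the globally minimal model; `tors` = `torsionOrder`; `tam` =
`tamagawaProduct`; output `a2_exp = ord₂ #Ш_an`), against census-1's algebraic exponent
`s₂ = ord₂ #Ш(E)[2^∞]`. A per-pair statement; it closes no class. Nothing booked; no mark moved. Unit
`b2b-bsdres-p2-typer` GEN 2; NEW file.

References: Miller, LMS J. Comput. Math. 14 (2011) Def 1.1 [Miller2011LMS]; Cremona, *Algorithms* §2.8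
(modular symbols for `L(E,1)/Ω`) [CremonaAlgorithms1997]; HOME/p2/census-2/SPEC.md §3.1, §7 (columns).
-/

noncomputable section

open scoped Classical

open WeierstrassCurve Literature.NumberTheory.EllipticCurves
  Literature.NumberTheory.EllipticCurves.Rank1Residual
  Literature.NumberTheory.EllipticCurves.Rank1Residual.Typed

set_option autoImplicit false

namespace Summit.BirchSwinnertonDyer.Rank1Residual.P2

variable (W : WeierstrassCurve ℚ) [W.IsElliptic]

/-- **SPEC OF THE RANK-ZERO ENGINE.** For an elliptic `W/ℚ` (read on the GLOBALLY MINIMAL model, the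
census convention — `shaAn` is Miller's `#Ш_an` there; the kernel statement needs no minimality) of
analytic rank `0`
with `L(E,1) = x · Ω_E` (`x = LoverOmega ∈ ℚ`, `Ω_E = realPeriodRat`, all real components), granted
GZK (`rank = 0`, `Ш` finite) and modularity (`x ≠ 0`): `#Ш_an(E) = x · #E(ℚ)_tor² / ∏ c_ℓ` and
`BSD(E,2) ⟺ ord₂ x = ord₂ #Ш(E) + ord₂ ∏ c_ℓ(E) − 2·ord₂ #E(ℚ)_tor` — binder ↦ column: `x` ↦
`LoverOmega` (SPEC §3.1, lattice `(1/(2cA))ℤ`, `manin`), `W.torsionOrder` ↦ `tors`,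
`W.tamagawaProduct` ↦ `tam`, `ord₂` of the right side's `#Ш` ↦ census-1's `s₂`; the valuation of
`#Ш_an` is the column `a2_exp`. [cite: Miller2011LMS, Def. 1.1 (arXiv:1010.2431 p. 3)] -/
theorem bsdp_two_iff_of_LoverOmega (hGZK : rank_eq_analyticRank_of_analyticRank_le_one)
    (hmod : hasEntireLFunction_rat) (hr : W.analyticRank = 0) {x : ℚ}
    (hx : W.entireLFunction 1 = (x : ℂ) * (W.realPeriodRat : ℂ)) :
    Finite W.sha ∧ shaAn W = ((x * (W.torsionOrder : ℚ) ^ 2 / (W.tamagawaProduct : ℚ) : ℚ) : ℂ) ∧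
      (BSDp W 2 ↔ padicValRat 2 x = (padicValNat 2 (Nat.card W.sha) : ℤ) +
        padicValNat 2 W.tamagawaProduct - 2 * padicValNat 2 W.torsionOrder) := by
  haveI : Fact (2 : ℕ).Prime := ⟨Nat.prime_two⟩
  obtain ⟨hrank, hfin⟩ := hGZK W (by rw [hr]; exact zero_le_one)
  haveI := hfin
  have hrk : W.mordellWeilRank = 0 := by rw [hrank, hr]
  have hL : W.leadingLCoeff = (x : ℂ) * (W.realPeriodRat : ℂ) * (W.regulator : ℂ) := by
    rw [leadingLCoeff_eq_of_analyticRank_eq_zero W hr, hx, W.regulator_eq_one_of_rank_zero hrk]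
    push_cast
    ring
  have hLne : W.entireLFunction 1 ≠ 0 := (W.analyticRank_eq_zero_iff_holds (hmod W)).1 hr
  have hx0 : x ≠ 0 := by
    rintro rfl
    exact hLne (by rw [hx]; simp)
  exact ⟨hfin, shaAn_eq_of_leadingLCoeff W hL, bsdp_iff_valuation_of_leadingLCoeff W 2 hrank hx0 hL⟩

/-- The same in the census currency: on an analytic-rank-`0` pair the MISSING OUTPUT
`MissingPPartAt W 2` IS the valuation identity of the r0 columns.
[cite: Miller2011LMS, Def. 1.1 (arXiv:1010.2431 p. 3)] -/
theorem missingPPartAt_two_iff_of_LoverOmega (hGZK : rank_eq_analyticRank_of_analyticRank_le_one)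
    (hmod : hasEntireLFunction_rat) (hr : W.analyticRank = 0) {x : ℚ}
    (hx : W.entireLFunction 1 = (x : ℂ) * (W.realPeriodRat : ℂ)) :
    MissingPPartAt W 2 ↔ padicValRat 2 x = (padicValNat 2 (Nat.card W.sha) : ℤ) +
        padicValNat 2 W.tamagawaProduct - 2 * padicValNat 2 W.torsionOrder := by
  obtain ⟨hfin, -, hiff⟩ := bsdp_two_iff_of_LoverOmega W hGZK hmod hr hx
  haveI := hfin
  haveI : Fact (2 : ℕ).Prime := ⟨Nat.prime_two⟩
  rw [← hiff]
  exact ⟨fun h => bsdp_of_missingPPartAt W 2 hGZK (by rw [hr]; exact zero_le_one) h,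
    fun h => missingPPartAt_of_bsdp W 2 h⟩

/-- **The two engine SPECs together cover the universe**: every curve of analytic rank `≤ 1` is
read by the rank-zero SPEC (`bsdp_two_iff_of_LoverOmega`, `r_an = 0`) or by the rank-one SPEC
(`bsdp_two_iff_of_heegner_rankOne`, `r_an = 1`, `P2/HeegnerIndexAtTwo.lean`) — the rank bit of the
grid. [folklore] -/
theorem analyticRank_eq_zero_or_eq_one_of_le_one {V : WeierstrassCurve ℚ} (h : V.analyticRank ≤ 1) :
    V.analyticRank = 0 ∨ V.analyticRank = 1 := by
  omega

/-! ## Appendix (GEN 3, append-only; REFUTER-O1 v26 §184 rider RZ-R1, p2-lead T-24): the SPEC is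
read on the GLOBALLY MINIMAL model — `#Ш_an` is model-dependent through `Ω`, by exactly `|u|` -/

/-- **Model dependence of Miller's `#Ш_an`, exactly.** Under a change of variables `C` (scalar `u`)
over `ℚ`: `#Ш_an(C • W) = #Ш_an(W) / |u|` — the leading coefficient, the torsion order, the Tamagawa
product and the regulator are isomorphism invariants (tree theorems `leadingLCoeff_smul`,
`torsionOrder_variableChange_holds`, `tamagawaProduct_variableChange_holds`,
`regulator_variableChange_holds`) while `Ω(C • W) = |u| · Ω(W)` (`realPeriodRat_smul_holds`). So
`ord₂ #Ш_an` moves by `−ord₂ u` (a `u = 2` rescale moves it by `1`): the SPECs of this lane are to be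
instantiated on GLOBALLY MINIMAL models only (the census reads Cremona's minimal models, so no census
word moves; refuter rider RZ-R1 answered as a theorem). [cite: Miller2011LMS, Def. 1.1 and §2 (minimal model convention)]
[cite: SilvermanAEC2009, III.1 Table 3.1] -/
theorem shaAn_smul (C : VariableChange ℚ) :
    shaAn (C • W) = shaAn W / ((|(C.u : ℚ)| : ℚ) : ℂ) := by
  have hΩ : (C • W).realPeriodRat = |((C.u : ℚ) : ℝ)| * W.realPeriodRat := realPeriodRat_smul_holds W C
  have ht : (C • W).torsionOrder = W.torsionOrder := torsionOrder_variableChange_holds W C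
  have hc : (C • W).tamagawaProduct = W.tamagawaProduct := tamagawaProduct_variableChange_holds W C
  have hR : (C • W).regulator = W.regulator := regulator_variableChange_holds W C
  have hcast : ((|((C.u : ℚ) : ℝ)| : ℝ) : ℂ) = ((|(C.u : ℚ)| : ℚ) : ℂ) := by
    rw [← Rat.cast_abs, Complex.ofReal_ratCast]
  rw [shaAn_def, shaAn_def, leadingLCoeff_smul, ht, hc, hR, hΩ]
  push_cast
  rw [hcast, div_div]
  ring

/-- **SPEC OF THE RANK-ZERO ENGINE, SCOPED TO THE GLOBALLY MINIMAL MODEL** (the intended reading of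
`bsdp_two_iff_of_LoverOmega`; REFUTER-O1 v26 rider RZ-R1 / p2-lead T-24). Miller's `BSD(E,2)` and
`#Ш_an` are defined on a chosen model and `BSDp W 2` is the `2`-part of the Birch–Swinnerton-Dyer
formula exactly when `W` is globally minimal (then `Ω_E = W.realPeriodRat` is the Néron period over
all real components and `shaAn W` is `#Ш(E)_an`; on a rescaled model `ord₂ shaAn` is off by `ord₂ u`,
`shaAn_smul`). INSTANTIATE ON GLOBALLY MINIMAL `W` ONLY: for such `W` of analytic rank `0` with
`L(E,1) = x · Ω_E`, granted GZK and modularity, `Ш(E)` is finite, `#Ш_an(E) = x·#E(ℚ)_tor²/∏c_ℓ`, and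
`BSD(E,2) ⟺ ord₂ x = ord₂ #Ш(E) + ord₂ ∏c_ℓ − 2·ord₂ #E(ℚ)_tor`.
[cite: Miller2011LMS, Def. 1.1 (arXiv:1010.2431 p. 3)] -/
theorem bsdp_two_iff_of_LoverOmega_of_isGloballyMinimal [W.IsGloballyMinimal]
    (hGZK : rank_eq_analyticRank_of_analyticRank_le_one)
    (hmod : hasEntireLFunction_rat) (hr : W.analyticRank = 0) {x : ℚ}
    (hx : W.entireLFunction 1 = (x : ℂ) * (W.realPeriodRat : ℂ)) :
    Finite W.sha ∧ shaAn W = ((x * (W.torsionOrder : ℚ) ^ 2 / (W.tamagawaProduct : ℚ) : ℚ) : ℂ) ∧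
      (BSDp W 2 ↔ padicValRat 2 x = (padicValNat 2 (Nat.card W.sha) : ℤ) +
        padicValNat 2 W.tamagawaProduct - 2 * padicValNat 2 W.torsionOrder) :=
  bsdp_two_iff_of_LoverOmega W hGZK hmod hr hx

end Summit.BirchSwinnertonDyer.Rank1Residual.P2

end
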